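import Summits.AtomisticToContinuum.BoseEinsteinCondensation.Theses.BECFisherTransfer
import Literature.MathematicalPhysics.QuantumManyBody.CondensateOccupationStability

/-!
# Route `BECFisherTransfer` — support item `PeriodicOccupationStability` (stmt-AtomisticToContinuum-9164)

Closes the shared support item stmt-AtomisticToContinuum-9164 (exact signature of
`Summit.AtomisticToContinuum.BoseEinsteinCondensation.Theses.BECFisherTransfer.PeriodicOccupationStability`):
for periodic trial states `Ψ, Φ ∈ PeriodicTrialState N L` (`0 < L`) and a unit complex number `c`,

  `n₀(Ψ)^{1/2} ≤ n₀(Φ)^{1/2} + N^{1/2} (∫_{Λ^N} |Ψ - cΦ|²)^{1/2}`,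

where `n₀ = condensateOccupation N L` is the expected occupation of the constant mode on the cell
`Λ^N = [0,L)^{3N}` [LSSY2005, §1.2 (1.17); Fournais2020, (1.3)–(1.5)].

Proof (bookkeeping over `Literature/…/CondensateOccupationStability.lean`): `√n₀ = ‖a₀ ·‖` is a
seminorm (`condensateOccupation_rpow_half_le_add`, Minkowski in `L²(Λ^{N-1})`), it is phase invariant
(`condensateOccupation_const_mul_of_norm_eq_one`), and `a₀` is bounded by `√N`
(`condensateOccupation_le_card_mul_lintegral`, the `k = 0` term of Parseval), so
`√n₀(Ψ) ≤ √n₀(cΦ) + √n₀(Ψ - cΦ) = √n₀(Φ) + √n₀(Ψ - cΦ) ≤ √n₀(Φ) + √N ‖Ψ - cΦ‖₂`.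
-/

noncomputable section

namespace Summit.AtomisticToContinuum.BoseEinsteinCondensation.Theorems

open MeasureTheory
open scoped ENNReal NNReal
open Literature.MathematicalPhysics.QuantumManyBody.BoseGas

/-- **`PeriodicOccupationStability`** (closes stmt-AtomisticToContinuum-9164, exact route signature):
for periodic trial states `Ψ, Φ` of `N` bosons on the torus of side `L > 0` and `|c| = 1`,
`n₀(Ψ)^{1/2} ≤ n₀(Φ)^{1/2} + N^{1/2} (∫_{Λ^N}|Ψ - cΦ|²)^{1/2}` — `√n₀` is a phase-invariant seminorm
dominated by `√N ‖·‖_{L²(Λ^N)}`. [cite: LSSY2005, §1.2 (1.17), App. A (A.11), (A.13)] -/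
theorem periodicOccupationStability_proof :
    Summit.AtomisticToContinuum.BoseEinsteinCondensation.Theses.BECFisherTransfer.PeriodicOccupationStability := by
  intro N L hL Ψ Φ c hc
  have hΨc : Continuous Ψ.ψ := Ψ.contDiff.continuous
  have hcΦc : Continuous fun X => c * Φ.ψ X := continuous_const.mul Φ.contDiff.continuous
  -- Minkowski: `√n₀(Ψ) ≤ √n₀(cΦ) + √n₀(Ψ - cΦ)`, and phase invariance `n₀(cΦ) = n₀(Φ)`
  have hmink := condensateOccupation_rpow_half_le_add L hΨc hcΦc
  rw [condensateOccupation_const_mul_of_norm_eq_one N L hc] at hmink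
  refine hmink.trans ?_
  gcongr
  -- `‖a₀‖ ≤ √N`: `n₀(Ψ - cΦ) ≤ N ∫_{Λ^N} |Ψ - cΦ|²`
  rw [← ENNReal.mul_rpow_of_nonneg _ _ (by norm_num : (0 : ℝ) ≤ 1 / 2)]
  exact ENNReal.rpow_le_rpow (condensateOccupation_le_card_mul_lintegral hL (hΨc.sub hcΦc))
    (by norm_num)

end Summit.AtomisticToContinuum.BoseEinsteinCondensation.Theorems
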